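import Summits.CriticalPhenomena.PercolationContinuityZ3.Theorems.PercNearOneGluingNoHeavyLowerTailAntitheticReachN
import Mathlib.Combinatorics.SimpleGraph.Connectivity.Finite
import HarnessLib

/-!
# `NoHeavyLowerTail` (stmt-CriticalPhenomena-4575) — antithetic cluster pairs: **THE 6-FAN FROM ITS HUB IS NOT ⊕_shift**, and **a rooted
# cone whose mixed shifted sum (M)_shift is NEGATIVE at a non-adjacent target pair** — two checked counterexamples marking the boundary
# of the handle/ear method (prim-hp-2 gen 68, HOME/MEMO-gen68.md §3)

Support file (`--supports stmt-CriticalPhenomena-4575`, hull-port prover `prim-hp-2`, gen 68).  No definitions, no named facts, no sorries;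
COMPUTATIONAL (`native_decide` evaluates two integer sums over `2^13` and `2^14` sub-colourings, clusters by the BFS ball `reachN` of
…AntitheticReachN).  Negative results: they kill no item and no theorem; they fix the range of two hypotheses.

(1) `Antithetic.Fan6.not_oplus_shift_powerset`.  The shifted ⊕-hypothesis `0 ≤ Σ_{θ : hub ∈ X θ} (F⁺(X θ) − F⁻(Y θ))·(G⁺(X θ) − G⁻(Y θ))`
(all monotone `F⁻ ≤ F⁺`, `G⁻ ≤ G⁺`), certified for the 4-fan (…AntitheticFan4Shift, kernel decider) and the 5-fan (…AntitheticFan5Sep,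
separable certificate) and consumed by THEOREMS F4H / F5H, FAILS for the 6-fan `s * K_{1,6}` at the hub: the single pair of monotone
functions `F⁺ = F⁻ = 𝟙[{5,6,7} ⊆ ·]`, `G⁺ = G⁻ = 𝟙[{2,3,4} ⊆ ·]` (three leaves each) gives `−46` (`Antithetic.Fan6.exists_negative_shift_pair`;
HOME/MEMO-gen67.md §4(c) had the value from the min-cut adversary).  Given that the hub is red-joined to `s`, "leaves 5,6,7 all red-joined"
and "leaves 2,3,4 all red-joined" (each minus its blue counterpart) are negatively correlated.  So F5H is the last fan obtainable from the dual
handle theorem; the shifted class rescues `K_{2,4}` and the 5-fan but not the 6-fan.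
(2) `Antithetic.ConeQ.not_mixed_shift_powerset`.  For the rooted cone `E = s * (K_{1,6} ⊔ Q)` — the 6-fan plus a pendant vertex `Q = 8` at
`s` — the MIXED hypothesis (M)_shift(E; P, Q) at `P =` hub, `Q = 8` fails with the same pair (`Q ∉ Y ⟺ sQ` red, so the mixed sum is the fan
sum): THEOREM M1 (`TwoStage.Cone.mixed_shift_nonneg`, …AntitheticConeMixedShift: (M)_shift `≥ 0` for every rooted cone and `P ∈ {Q} ∪ N(Q)`)
does NOT extend to all `(P, Q)`, i.e. CONJECTURE CM of HOME/MEMO-gen67.md §6 (P3) is false as stated; every counterexample of this kind has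
`P` and `Q` in different components of the base (HOME/MEMO-gen68.md §3 keeps CM for `P, Q` in one component, where the BHK fibres carry
a nonempty red pin `N_H(S)`).
[cite: VandenbergHaggstromKahn2005, §1 p. 3 (open cluster `C_s`)]
-/

namespace Summit.CriticalPhenomena.PercolationContinuityZ3.Theorems

open Literature.Probability.Percolation

namespace Antithetic

namespace NegTools

/-- Casting an integer certificate: if `Σ (a − b)(c − d) < 0` over `ℤ` then the same sum of the real casts is `< 0`.  (Keeps the kernel away
from the big concrete sums: all non-syntactic matching happens on variables.) [folklore] -/
theorem cast_sum_neg {β : Type*} (S : Finset β) (a b c d : β → ℤ)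
    (h : ∑ x ∈ S, (a x - b x) * (c x - d x) < 0) :
    ∑ x ∈ S, (((a x : ℤ) : ℝ) - ((b x : ℤ) : ℝ)) * (((c x : ℤ) : ℝ) - ((d x : ℤ) : ℝ)) < 0 := by
  have h' : (((∑ x ∈ S, (a x - b x) * (c x - d x) : ℤ)) : ℝ) < 0 := by exact_mod_cast h
  push_cast at h'
  exact h'

end NegTools

namespace Fan6

set_option maxRecDepth 8192 in
/-- **An explicit nested monotone pair with NEGATIVE shifted ⊕-sum on the 6-fan at the hub.**  With `F⁺ = F⁻ = 𝟙[{5,6,7} ⊆ ·]` and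
`G⁺ = G⁻ = 𝟙[{2,3,4} ⊆ ·]` (three leaves each): `Σ_{θ ⊆ E₁, 1 ∈ X θ} (F⁺(X θ) − F⁻(Y θ))·(G⁺(X θ) − G⁻(Y θ)) = −46 < 0` for the
fan `E₁ = {01, 02, …, 07, 12, …, 17}` (source `0`, hub `1`, leaves `2, …, 7`). [this work, checked computation] -/
theorem exists_negative_shift_pair : ∃ Fp Fm Gp Gm : Set (Fin 8) → ℝ,
    Monotone Fp ∧ Monotone Fm ∧ (∀ S, Fm S ≤ Fp S) ∧ Monotone Gp ∧ Monotone Gm ∧ (∀ S, Gm S ≤ Gp S) ∧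
    ∑ θ ∈ (Finset.powerset ({s(0, 1), s(0, 2), s(0, 3), s(0, 4), s(0, 5), s(0, 6), s(0, 7), s(1, 2), s(1, 3), s(1, 4), s(1, 5), s(1, 6), s(1, 7)} : Finset (Sym2 (Fin 8)))).filter (fun (θ : Finset (Sym2 (Fin 8))) =>
        (SimpleGraph.fromEdgeSet (↑θ : Set (Sym2 (Fin 8)))).Reachable 0 1),
      (Fp (openCluster (↑θ : Set (Sym2 (Fin 8))) 0) - Fm (openCluster (↑(({s(0, 1), s(0, 2), s(0, 3), s(0, 4), s(0, 5), s(0, 6), s(0, 7), s(1, 2), s(1, 3), s(1, 4), s(1, 5), s(1, 6), s(1, 7)} : Finset (Sym2 (Fin 8))) \ θ) : Set (Sym2 (Fin 8))) 0)) *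
        (Gp (openCluster (↑θ : Set (Sym2 (Fin 8))) 0) - Gm (openCluster (↑(({s(0, 1), s(0, 2), s(0, 3), s(0, 4), s(0, 5), s(0, 6), s(0, 7), s(1, 2), s(1, 3), s(1, 4), s(1, 5), s(1, 6), s(1, 7)} : Finset (Sym2 (Fin 8))) \ θ) : Set (Sym2 (Fin 8))) 0)) < 0 := by
  -- monotonicity of an indicator `[g ⊆ A]` through `Set.toFinset`
  have hmono : ∀ (g : Finset (Fin 8)), Monotone (fun A : Set (Fin 8) =>
      (((if g ⊆ @Set.toFinset _ A (Fintype.ofFinite A) then (1 : ℤ) else 0 : ℤ) : ℝ))) := by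
    intro g A A' hA
    have hA' : @Set.toFinset _ A (Fintype.ofFinite A) ⊆ @Set.toFinset _ A' (Fintype.ofFinite A') :=
      (@Set.toFinset_subset_toFinset _ A A' (Fintype.ofFinite A) (Fintype.ofFinite A')).2 hA
    dsimp only
    split_ifs with h1 h2
    · exact le_rfl
    · exact absurd (h1.trans hA') h2
    · exact_mod_cast zero_le_one
    · exact le_rfl
  -- cluster computations by the BFS ball `reachN`
  have hX : ∀ θ : Finset (Sym2 (Fin 8)), openCluster (↑θ : Set (Sym2 (Fin 8))) 0 = ↑(reachN θ (0 : Fin 8) 7) := fun θ =>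
    openCluster_eq_coe_reachN θ (0 : Fin 8) (by simp)
  have hD : (Finset.powerset ({s(0, 1), s(0, 2), s(0, 3), s(0, 4), s(0, 5), s(0, 6), s(0, 7), s(1, 2), s(1, 3), s(1, 4), s(1, 5), s(1, 6), s(1, 7)} : Finset (Sym2 (Fin 8)))).filter (fun (θ : Finset (Sym2 (Fin 8))) =>
        (SimpleGraph.fromEdgeSet (↑θ : Set (Sym2 (Fin 8)))).Reachable 0 1) =
      (Finset.powerset ({s(0, 1), s(0, 2), s(0, 3), s(0, 4), s(0, 5), s(0, 6), s(0, 7), s(1, 2), s(1, 3), s(1, 4), s(1, 5), s(1, 6), s(1, 7)} : Finset (Sym2 (Fin 8)))).filter (fun (θ : Finset (Sym2 (Fin 8))) => (1 : Fin 8) ∈ reachN θ (0 : Fin 8) 7) := by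
    refine Finset.filter_congr fun θ _ => ?_
    rw [mem_reachN_iff θ (0 : Fin 8) (1 : Fin 8) (by simp)]
  refine ⟨fun A => (((if ({5, 6, 7} : Finset (Fin 8)) ⊆ @Set.toFinset _ A (Fintype.ofFinite A) then (1 : ℤ) else 0 : ℤ) : ℝ)), fun A => (((if ({5, 6, 7} : Finset (Fin 8)) ⊆ @Set.toFinset _ A (Fintype.ofFinite A) then (1 : ℤ) else 0 : ℤ) : ℝ)),
    fun A => (((if ({2, 3, 4} : Finset (Fin 8)) ⊆ @Set.toFinset _ A (Fintype.ofFinite A) then (1 : ℤ) else 0 : ℤ) : ℝ)), fun A => (((if ({2, 3, 4} : Finset (Fin 8)) ⊆ @Set.toFinset _ A (Fintype.ofFinite A) then (1 : ℤ) else 0 : ℤ) : ℝ)),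
    hmono _, hmono _, fun S => le_rfl, hmono _, hmono _, fun S => le_rfl, ?_⟩
  rw [hD]
  simp only [hX, Finset.toFinset_coe]
  refine NegTools.cast_sum_neg _ _ _ _ _ ?_
  native_decide

/-- **The 6-fan from the hub is NOT ⊕_shift-positive.**  The hypothesis (⊕)_shift of the dual handle theorem
(…AntitheticHandleDualShift), which `…AntitheticFan5Sep.oplus_shift_powerset` certifies for the 5-fan, FAILS for the 6-fan: THEOREM F5H
is the last fan-with-handle theorem obtainable from (⊕)_shift + (M)_shift. [this work] -/
theorem not_oplus_shift_powerset : ¬ ∀ Fp Fm Gp Gm : Set (Fin 8) → ℝ, Monotone Fp → Monotone Fm → (∀ S, Fm S ≤ Fp S) →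
    Monotone Gp → Monotone Gm → (∀ S, Gm S ≤ Gp S) →
    0 ≤ ∑ θ ∈ (Finset.powerset ({s(0, 1), s(0, 2), s(0, 3), s(0, 4), s(0, 5), s(0, 6), s(0, 7), s(1, 2), s(1, 3), s(1, 4), s(1, 5), s(1, 6), s(1, 7)} : Finset (Sym2 (Fin 8)))).filter (fun (θ : Finset (Sym2 (Fin 8))) =>
        (SimpleGraph.fromEdgeSet (↑θ : Set (Sym2 (Fin 8)))).Reachable 0 1),
      (Fp (openCluster (↑θ : Set (Sym2 (Fin 8))) 0) - Fm (openCluster (↑(({s(0, 1), s(0, 2), s(0, 3), s(0, 4), s(0, 5), s(0, 6), s(0, 7), s(1, 2), s(1, 3), s(1, 4), s(1, 5), s(1, 6), s(1, 7)} : Finset (Sym2 (Fin 8))) \ θ) : Set (Sym2 (Fin 8))) 0)) *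
        (Gp (openCluster (↑θ : Set (Sym2 (Fin 8))) 0) - Gm (openCluster (↑(({s(0, 1), s(0, 2), s(0, 3), s(0, 4), s(0, 5), s(0, 6), s(0, 7), s(1, 2), s(1, 3), s(1, 4), s(1, 5), s(1, 6), s(1, 7)} : Finset (Sym2 (Fin 8))) \ θ) : Set (Sym2 (Fin 8))) 0)) := by
  intro h
  obtain ⟨Fp, Fm, Gp, Gm, hFp, hFm, hF, hGp, hGm, hG, hlt⟩ := exists_negative_shift_pair
  exact absurd (h Fp Fm Gp Gm hFp hFm hF hGp hGm hG) (not_le.2 hlt)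

end Fan6

namespace ConeQ

set_option maxRecDepth 8192 in
/-- **The same pair is a NEGATIVE mixed shifted sum for a rooted cone at a NON-ADJACENT target pair.**  For the cone `s * (K_{1,6} ⊔ Q)`
(`s = 0`, star with hub `1` and leaves `2, …, 7`, and an ISOLATED vertex `Q = 8` of the base, i.e. a pendant vertex of the cone at `s`):
`Σ_{θ : 1 ∈ X θ, 8 ∉ Y θ} (F⁺(X θ) − F⁻(Y θ))·(G⁺(X θ) − G⁻(Y θ)) = −46 < 0` (`8 ∉ Y θ ⟺ 08` red, so this is the fan sum above).
[this work, checked computation] -/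
theorem exists_negative_mixed_pair : ∃ Fp Fm Gp Gm : Set (Fin 9) → ℝ,
    Monotone Fp ∧ Monotone Fm ∧ (∀ S, Fm S ≤ Fp S) ∧ Monotone Gp ∧ Monotone Gm ∧ (∀ S, Gm S ≤ Gp S) ∧
    ∑ θ ∈ (Finset.powerset ({s(0, 1), s(0, 2), s(0, 3), s(0, 4), s(0, 5), s(0, 6), s(0, 7), s(1, 2), s(1, 3), s(1, 4), s(1, 5), s(1, 6), s(1, 7), s(0, 8)} : Finset (Sym2 (Fin 9)))).filter (fun (θ : Finset (Sym2 (Fin 9))) =>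
        (SimpleGraph.fromEdgeSet (↑θ : Set (Sym2 (Fin 9)))).Reachable 0 1
          ∧ ¬ (SimpleGraph.fromEdgeSet (↑(({s(0, 1), s(0, 2), s(0, 3), s(0, 4), s(0, 5), s(0, 6), s(0, 7), s(1, 2), s(1, 3), s(1, 4), s(1, 5), s(1, 6), s(1, 7), s(0, 8)} : Finset (Sym2 (Fin 9))) \ θ) : Set (Sym2 (Fin 9)))).Reachable 0 8),
      (Fp (openCluster (↑θ : Set (Sym2 (Fin 9))) 0) - Fm (openCluster (↑(({s(0, 1), s(0, 2), s(0, 3), s(0, 4), s(0, 5), s(0, 6), s(0, 7), s(1, 2), s(1, 3), s(1, 4), s(1, 5), s(1, 6), s(1, 7), s(0, 8)} : Finset (Sym2 (Fin 9))) \ θ) : Set (Sym2 (Fin 9))) 0)) *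
        (Gp (openCluster (↑θ : Set (Sym2 (Fin 9))) 0) - Gm (openCluster (↑(({s(0, 1), s(0, 2), s(0, 3), s(0, 4), s(0, 5), s(0, 6), s(0, 7), s(1, 2), s(1, 3), s(1, 4), s(1, 5), s(1, 6), s(1, 7), s(0, 8)} : Finset (Sym2 (Fin 9))) \ θ) : Set (Sym2 (Fin 9))) 0)) < 0 := by
  -- monotonicity of an indicator `[g ⊆ A]` through `Set.toFinset`
  have hmono : ∀ (g : Finset (Fin 9)), Monotone (fun A : Set (Fin 9) =>
      (((if g ⊆ @Set.toFinset _ A (Fintype.ofFinite A) then (1 : ℤ) else 0 : ℤ) : ℝ))) := by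
    intro g A A' hA
    have hA' : @Set.toFinset _ A (Fintype.ofFinite A) ⊆ @Set.toFinset _ A' (Fintype.ofFinite A') :=
      (@Set.toFinset_subset_toFinset _ A A' (Fintype.ofFinite A) (Fintype.ofFinite A')).2 hA
    dsimp only
    split_ifs with h1 h2
    · exact le_rfl
    · exact absurd (h1.trans hA') h2
    · exact_mod_cast zero_le_one
    · exact le_rfl
  -- cluster computations by the BFS ball `reachN`
  have hX : ∀ θ : Finset (Sym2 (Fin 9)), openCluster (↑θ : Set (Sym2 (Fin 9))) 0 = ↑(reachN θ (0 : Fin 9) 8) := fun θ =>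
    openCluster_eq_coe_reachN θ (0 : Fin 9) (by simp)
  have hD : (Finset.powerset ({s(0, 1), s(0, 2), s(0, 3), s(0, 4), s(0, 5), s(0, 6), s(0, 7), s(1, 2), s(1, 3), s(1, 4), s(1, 5), s(1, 6), s(1, 7), s(0, 8)} : Finset (Sym2 (Fin 9)))).filter (fun (θ : Finset (Sym2 (Fin 9))) =>
        (SimpleGraph.fromEdgeSet (↑θ : Set (Sym2 (Fin 9)))).Reachable 0 1
          ∧ ¬ (SimpleGraph.fromEdgeSet (↑(({s(0, 1), s(0, 2), s(0, 3), s(0, 4), s(0, 5), s(0, 6), s(0, 7), s(1, 2), s(1, 3), s(1, 4), s(1, 5), s(1, 6), s(1, 7), s(0, 8)} : Finset (Sym2 (Fin 9))) \ θ) : Set (Sym2 (Fin 9)))).Reachable 0 8) =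
      (Finset.powerset ({s(0, 1), s(0, 2), s(0, 3), s(0, 4), s(0, 5), s(0, 6), s(0, 7), s(1, 2), s(1, 3), s(1, 4), s(1, 5), s(1, 6), s(1, 7), s(0, 8)} : Finset (Sym2 (Fin 9)))).filter (fun (θ : Finset (Sym2 (Fin 9))) => (1 : Fin 9) ∈ reachN θ (0 : Fin 9) 8 ∧
          ¬ ((8 : Fin 9) ∈ reachN (({s(0, 1), s(0, 2), s(0, 3), s(0, 4), s(0, 5), s(0, 6), s(0, 7), s(1, 2), s(1, 3), s(1, 4), s(1, 5), s(1, 6), s(1, 7), s(0, 8)} : Finset (Sym2 (Fin 9))) \ θ) (0 : Fin 9) 8)) := by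
    refine Finset.filter_congr fun θ _ => ?_
    rw [mem_reachN_iff θ (0 : Fin 9) (1 : Fin 9) (by simp), mem_reachN_iff _ (0 : Fin 9) (8 : Fin 9) (by simp)]
  refine ⟨fun A => (((if ({5, 6, 7} : Finset (Fin 9)) ⊆ @Set.toFinset _ A (Fintype.ofFinite A) then (1 : ℤ) else 0 : ℤ) : ℝ)), fun A => (((if ({5, 6, 7} : Finset (Fin 9)) ⊆ @Set.toFinset _ A (Fintype.ofFinite A) then (1 : ℤ) else 0 : ℤ) : ℝ)),
    fun A => (((if ({2, 3, 4} : Finset (Fin 9)) ⊆ @Set.toFinset _ A (Fintype.ofFinite A) then (1 : ℤ) else 0 : ℤ) : ℝ)), fun A => (((if ({2, 3, 4} : Finset (Fin 9)) ⊆ @Set.toFinset _ A (Fintype.ofFinite A) then (1 : ℤ) else 0 : ℤ) : ℝ)),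
    hmono _, hmono _, fun S => le_rfl, hmono _, hmono _, fun S => le_rfl, ?_⟩
  rw [hD]
  simp only [hX, Finset.toFinset_coe]
  refine NegTools.cast_sum_neg _ _ _ _ _ ?_
  native_decide

/-- **CONJECTURE CM is false for disconnected bases / THEOREM M1 needs `P ∈ N[Q]`.**  (M)_shift(E; P, Q) FAILS for the rooted cone
`s * (K_{1,6} ⊔ Q)` at `P =` hub, `Q =` the isolated base vertex (so `PQ ∉ E`, `P ≠ Q`): the conclusion of
`TwoStage.Cone.mixed_shift_nonneg` (…AntitheticConeMixedShift) does not extend to all target pairs of all cones.  HOME/MEMO-gen68.md §3: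
the surviving form of CONJECTURE CM asks `P, Q` in the same component of the base. [this work] -/
theorem not_mixed_shift_powerset : ¬ ∀ Fp Fm Gp Gm : Set (Fin 9) → ℝ, Monotone Fp → Monotone Fm → (∀ S, Fm S ≤ Fp S) →
    Monotone Gp → Monotone Gm → (∀ S, Gm S ≤ Gp S) →
    0 ≤ ∑ θ ∈ (Finset.powerset ({s(0, 1), s(0, 2), s(0, 3), s(0, 4), s(0, 5), s(0, 6), s(0, 7), s(1, 2), s(1, 3), s(1, 4), s(1, 5), s(1, 6), s(1, 7), s(0, 8)} : Finset (Sym2 (Fin 9)))).filter (fun (θ : Finset (Sym2 (Fin 9))) =>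
        (SimpleGraph.fromEdgeSet (↑θ : Set (Sym2 (Fin 9)))).Reachable 0 1
          ∧ ¬ (SimpleGraph.fromEdgeSet (↑(({s(0, 1), s(0, 2), s(0, 3), s(0, 4), s(0, 5), s(0, 6), s(0, 7), s(1, 2), s(1, 3), s(1, 4), s(1, 5), s(1, 6), s(1, 7), s(0, 8)} : Finset (Sym2 (Fin 9))) \ θ) : Set (Sym2 (Fin 9)))).Reachable 0 8),
      (Fp (openCluster (↑θ : Set (Sym2 (Fin 9))) 0) - Fm (openCluster (↑(({s(0, 1), s(0, 2), s(0, 3), s(0, 4), s(0, 5), s(0, 6), s(0, 7), s(1, 2), s(1, 3), s(1, 4), s(1, 5), s(1, 6), s(1, 7), s(0, 8)} : Finset (Sym2 (Fin 9))) \ θ) : Set (Sym2 (Fin 9))) 0)) *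
        (Gp (openCluster (↑θ : Set (Sym2 (Fin 9))) 0) - Gm (openCluster (↑(({s(0, 1), s(0, 2), s(0, 3), s(0, 4), s(0, 5), s(0, 6), s(0, 7), s(1, 2), s(1, 3), s(1, 4), s(1, 5), s(1, 6), s(1, 7), s(0, 8)} : Finset (Sym2 (Fin 9))) \ θ) : Set (Sym2 (Fin 9))) 0)) := by
  intro h
  obtain ⟨Fp, Fm, Gp, Gm, hFp, hFm, hF, hGp, hGm, hG, hlt⟩ := exists_negative_mixed_pair
  exact absurd (h Fp Fm Gp Gm hFp hFm hF hGp hGm hG) (not_le.2 hlt)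

end ConeQ

end Antithetic

end Summit.CriticalPhenomena.PercolationContinuityZ3.Theorems
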